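import Summits.CriticalPhenomena.PercolationContinuityZ3.Theorems.PercNearOneGluingNoHeavyLowerTailSahiGridPatternTensor

/-!
# `NoHeavyLowerTail` (crux stmt-CriticalPhenomena-4575), Sahi programme P1: **the pattern tensor and SLICE CERTIFICATES in
# EVERY dimension** — `PatternPos d` follows from finitely many exact linear certificates, for every `d`

Support file (Sahi cell, seat `prim-sahi-p1`, generation 8; `--supports stmt-CriticalPhenomena-4575`).  Pure proofs; the only
definitions are the closed form `tcD` of the pattern tensor on `[3]^d`, the generator values `gval`, the certificate evaluation
`certVal`, the Boolean certificate checker `certCheck` and the obligation `SliceDecomposable d`; no `sorry`, no `native_decide`, standard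
axioms.  This is the dimension-free form of the generation-7 files `…SahiGridPatternTensor` / `…Cover` / `…Kernel` (which treat
`d = 3` with literal tables).

THE MATHEMATICS.  Let `P_d = [3]^d` and `sStarD A B C = Σ_{π ∈ S₃^d} h(P^π_0, P^π_1, P^π_2)` be the pattern functional of
`…SahiGridPattern` (`PatternPos d :⟺ sStarD ≥ 0` on up-set triples; `∀ d, PatternPos d ⟹` Kahn's Conjecture 5).
* `sStarD_single_all`, `sStarD_eq_sum_tcD`: `sStarD` is TRILINEAR with tensor
  `t_d(p,q,r) = 2∏_a 2[p_a=q_a=r_a] − ∏_a[p_a≠q_a=r_a] − ∏_a[q_a≠p_a=r_a] − ∏_a[r_a≠p_a=q_a] + ∏_a[p_a,q_a,r_a distinct]`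
  (`tcD`; the sum over `S₃^d` of axis-wise products factorises axis by axis) — for EVERY `d` (`tcD_three`: at `d = 3` it is the
  generation-7 tensor `tcP`).
* SLICE CERTIFICATES.  For an up-set `A` put `β_A(q,r) = Σ_{p ∈ A} t_d(p,q,r)`.  A certificate for `A` is an identity
  `L·β_A(q,r) = Σ_k c_k γ_k(q) γ'_k(r)` (all `q, r`) with `L > 0`, `c_k ∈ ℕ` and each `γ` a POINT EVALUATION `x ↦ [x = p]` or an
  UPWARD DIFFERENCE `x ↦ [x = hi] − [x = lo]`, `lo ≤ hi` (`gval`; `sum_gval_nonneg`: `Σ_{x ∈ B} γ(x) ≥ 0` for every up-set `B` —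
  these functionals generate the dual cone of the up-sets).  `slicePos_of_certCheck`: a certificate for `A` proves
  `Σ_{p∈A, q∈B, r∈C} t_d(p,q,r) ≥ 0` for ALL up-sets `B, C`; `patternPos_of_sliceDecomposable`: certificates for all up-sets `A`
  (`SliceDecomposable d`) give `PatternPos d`; `patternPos_of_certs_upToAxisPerm`: one certificate per ORBIT of up-sets under the
  axis permutations `S_d` suffices (`tcD_perm`: `t_d` is `S_d`-invariant).  Consequences (`liebSahi_grid_of_sliceDecomposable`,
  `kahnConjecture_of_forall_sliceDecomposable`) are the generation-7 reductions composed with this one.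
STATUS / HONEST LABELS.  `SliceDecomposable d` is an obligation, never a fact.  It HOLDS for `d ≤ 3` (generation 7: all 980
up-sets of `[3]^3`, kernel-checked in `…SahiGridPatternSlices1–16` / `…Kernel` in the `d = 3`-specific format).  For `d = 4`
(17 792 748 up-sets, 763 864 axis orbits) exact integer certificates are being computed and verified OUTSIDE Lean by this seat
(HiGHS interior point + exact rational solve of the basis system; two independent exact checkers; evidence on item 4575) — when
complete this gives `PatternPos 4` at CERTIFICATE grade (too large for the kernel: ≈ 1.8·10⁹ certificate terms); nothing in this
file asserts it.  Whether `SliceDecomposable d` holds for all `d` is OPEN (it would prove Kahn's conjecture); note that the full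
tensor `t_d` is NOT a nonnegative combination of triple products `γ⊗γ'⊗γ''` for `d ≥ 3` (generation 7, exact Farkas witness),
so slice-by-slice decomposability is the finest product structure available. [this work]
-/

namespace Summit.CriticalPhenomena.PercolationContinuityZ3.Theorems.SahiGridPattern

open Finset SahiGrid3
open scoped BigOperators

variable {d : ℕ}

/-! ### The pattern tensor in closed form, every dimension -/

/-- **The pattern tensor on `[3]^d` in closed form**: products over the `d` axes of the per-axis counts `c1, c2, c3`. [this work] -/
def tcD (p q r : Pd d) : ℤ :=
  2 * ∏ a, c1 (p a) (q a) (r a) - ∏ a, c2 (p a) (q a) (r a) - ∏ a, c2 (q a) (p a) (r a)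
    - ∏ a, c2 (r a) (p a) (q a) + ∏ a, c3 (p a) (q a) (r a)

/-- At `d = 3` the closed form is the generation-7 tensor `tcP`. [this work] -/
theorem tcD_three (p q r : P3) : tcD p q r = tcP p q r := by
  simp only [tcD, tcP, Fin.prod_univ_three]

/-- Sums over `S₃^d` of products of per-axis conditions factor over the axes. [this work] -/
theorem sum_pi_boole_all (P : Fin d → Equiv.Perm (Fin 3) → Prop) [∀ a σ, Decidable (P a σ)] :
    (∑ π : Fin d → Equiv.Perm (Fin 3), if (∀ a, P a (π a)) then (1 : ℤ) else 0) =
      ∏ a, ∑ σ : Equiv.Perm (Fin 3), if P a σ then (1 : ℤ) else 0 := by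
  rw [Finset.prod_univ_sum]
  simp only [Fintype.piFinset_univ]
  refine Finset.sum_congr rfl fun π _ => ?_
  rw [Finset.prod_boole]
  simp

/-- Indicator of a singleton of the small cube `[3]^d`. [this work] -/
theorem ind_single_all (p x : Pd d) : ind ({p} : Finset (Pd d)) x = if x = p then 1 else 0 := by
  unfold ind; simp only [mem_singleton]

/-- A triple product of point-equality indicators at pattern points is the indicator of an axis-wise condition. [this work] -/
theorem ite3_eq_all (π : Fin d → Equiv.Perm (Fin 3)) (i j k : Fin 3) (p q r : Pd d) :
    ((if col π i = p then (1:ℤ) else 0) * (if col π j = q then 1 else 0) * (if col π k = r then 1 else 0)) =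
      if (∀ a, π a i = p a ∧ π a j = q a ∧ π a k = r a) then 1 else 0 := by
  have e1 : col π i = p ↔ ∀ a, π a i = p a := funext_iff
  have e2 : col π j = q ↔ ∀ a, π a j = q a := funext_iff
  have e3 : col π k = r ↔ ∀ a, π a k = r a := funext_iff
  by_cases h1 : col π i = p <;> by_cases h2 : col π j = q <;> by_cases h3 : col π k = r <;>
    simp only [h1, h2, h3, if_true, if_false, mul_one, mul_zero] <;>
    first
    | (rw [if_pos]; intro a; exact ⟨(e1.1 h1) a, (e2.1 h2) a, (e3.1 h3) a⟩)
    | (rw [if_neg]; intro h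
       first
       | exact h1 (e1.2 fun a => (h a).1)
       | exact h2 (e2.2 fun a => (h a).2.1)
       | exact h3 (e3.2 fun a => (h a).2.2))

/-- **Closed form in every dimension**: `sStarD {p} {q} {r} = tcD p q r`. [this work] -/
theorem sStarD_single_all (p q r : Pd d) : sStarD ({p} : Finset (Pd d)) {q} {r} = tcD p q r := by
  unfold sStarD hZ
  simp only [ind_single_all]
  simp only [Finset.sum_add_distrib, Finset.sum_sub_distrib, ite3_eq_all]
  have t1 : (∑ π : Fin d → Equiv.Perm (Fin 3), (2:ℤ) * if (∀ a, π a 0 = p a ∧ π a 0 = q a ∧ π a 0 = r a) then 1 else 0)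
      = 2 * ∏ a, c1 (p a) (q a) (r a) := by
    rw [← Finset.mul_sum, sum_pi_boole_all (fun a σ => σ 0 = p a ∧ σ 0 = q a ∧ σ 0 = r a)]
    exact congrArg _ (Finset.prod_congr rfl fun a _ => count1 _ _ _)
  have t2 : (∑ π : Fin d → Equiv.Perm (Fin 3), if (∀ a, π a 0 = p a ∧ π a 1 = q a ∧ π a 1 = r a) then (1:ℤ) else 0)
      = ∏ a, c2 (p a) (q a) (r a) := by
    rw [sum_pi_boole_all (fun a σ => σ 0 = p a ∧ σ 1 = q a ∧ σ 1 = r a)]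
    exact Finset.prod_congr rfl fun a _ => count2 _ _ _
  have t3 : (∑ π : Fin d → Equiv.Perm (Fin 3), if (∀ a, π a 0 = q a ∧ π a 1 = p a ∧ π a 1 = r a) then (1:ℤ) else 0)
      = ∏ a, c2 (q a) (p a) (r a) := by
    rw [sum_pi_boole_all (fun a σ => σ 0 = q a ∧ σ 1 = p a ∧ σ 1 = r a)]
    exact Finset.prod_congr rfl fun a _ => count2 _ _ _
  have t4 : (∑ π : Fin d → Equiv.Perm (Fin 3), if (∀ a, π a 0 = r a ∧ π a 1 = p a ∧ π a 1 = q a) then (1:ℤ) else 0)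
      = ∏ a, c2 (r a) (p a) (q a) := by
    rw [sum_pi_boole_all (fun a σ => σ 0 = r a ∧ σ 1 = p a ∧ σ 1 = q a)]
    exact Finset.prod_congr rfl fun a _ => count2 _ _ _
  have t5 : (∑ π : Fin d → Equiv.Perm (Fin 3), if (∀ a, π a 0 = p a ∧ π a 1 = q a ∧ π a 2 = r a) then (1:ℤ) else 0)
      = ∏ a, c3 (p a) (q a) (r a) := by
    rw [sum_pi_boole_all (fun a σ => σ 0 = p a ∧ σ 1 = q a ∧ σ 2 = r a)]
    exact Finset.prod_congr rfl fun a _ => count3 _ _ _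
  rw [t1, t2, t3, t4, t5]
  rfl

/-! ### Trilinear expansion, every dimension -/

/-- Product of three indicator sums, expanded (any finite type). [this work] -/
theorem ind_mul3_eq_sum_all {Y : Type*} [DecidableEq Y] (A B C : Finset Y) (s t u : Y) :
    ind A s * ind B t * ind C u = ∑ a ∈ A, ∑ b ∈ B, ∑ c ∈ C, ind {a} s * ind {b} t * ind {c} u := by
  rw [ind_eq_sum_single A s, ind_eq_sum_single B t, ind_eq_sum_single C u, Finset.sum_mul_sum, Finset.sum_mul]
  refine Finset.sum_congr rfl fun a _ => ?_
  rw [Finset.sum_mul]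
  refine Finset.sum_congr rfl fun b _ => ?_
  rw [Finset.mul_sum]

/-- The three-copy kernel is trilinear in the indicator functions (any finite type). [this work] -/
theorem hZ_eq_sum_single_all {Y : Type*} [DecidableEq Y] (A B C : Finset Y) (x y z : Y) :
    hZ A B C x y z = ∑ a ∈ A, ∑ b ∈ B, ∑ c ∈ C, hZ {a} {b} {c} x y z := by
  have k1 := ind_mul3_eq_sum_all A B C x x x
  have k2 := ind_mul3_eq_sum_all A B C x y y
  have k3 : ind B x * ind A y * ind C y = ∑ a ∈ A, ∑ b ∈ B, ∑ c ∈ C, ind {b} x * ind {a} y * ind {c} y := by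
    rw [show ind B x * ind A y * ind C y = ind A y * ind B x * ind C y by ring, ind_mul3_eq_sum_all]
    exact Finset.sum_congr rfl fun a _ => Finset.sum_congr rfl fun b _ => Finset.sum_congr rfl fun c _ => by ring
  have k4 : ind C x * ind A y * ind B y = ∑ a ∈ A, ∑ b ∈ B, ∑ c ∈ C, ind {c} x * ind {a} y * ind {b} y := by
    rw [show ind C x * ind A y * ind B y = ind A y * ind B y * ind C x by ring, ind_mul3_eq_sum_all]
    exact Finset.sum_congr rfl fun a _ => Finset.sum_congr rfl fun b _ => Finset.sum_congr rfl fun c _ => by ring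
  have k5 := ind_mul3_eq_sum_all A B C x y z
  unfold hZ
  rw [k1, k2, k3, k4, k5]
  simp only [Finset.mul_sum, ← Finset.sum_sub_distrib, ← Finset.sum_add_distrib]

/-- **`sStarD A B C = Σ_{p∈A} Σ_{q∈B} Σ_{r∈C} t_d(p,q,r)`** in every dimension. [this work] -/
theorem sStarD_eq_sum_tcD (A B C : Finset (Pd d)) : sStarD A B C = ∑ p ∈ A, ∑ q ∈ B, ∑ r ∈ C, tcD p q r := by
  have h1 : sStarD A B C = ∑ p ∈ A, ∑ q ∈ B, ∑ r ∈ C, sStarD ({p} : Finset (Pd d)) {q} {r} := by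
    unfold sStarD
    simp_rw [hZ_eq_sum_single_all A B C]
    rw [Finset.sum_comm]
    refine Finset.sum_congr rfl fun p _ => ?_
    rw [Finset.sum_comm]
    refine Finset.sum_congr rfl fun q _ => ?_
    rw [Finset.sum_comm]
  rw [h1]
  simp only [sStarD_single_all]

/-! ### Generators of the dual cone of up-sets: point evaluations and upward differences -/

/-- Value at `x` of the generator `e = (lo, hi)`: the point evaluation `[x = lo]` if `lo = hi`, else the upward difference
`[x = hi] − [x = lo]` (meant for `lo ≤ hi`). [this work] -/
def gval (e : Pd d × Pd d) (x : Pd d) : ℤ :=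
  if e.1 = e.2 then (if x = e.1 then 1 else 0) else ((if x = e.2 then 1 else 0) - (if x = e.1 then 1 else 0))

/-- Sum of a point indicator over a finset. [this work] -/
theorem sum_ite_eq_ind (B : Finset (Pd d)) (p : Pd d) : (∑ x ∈ B, if x = p then (1:ℤ) else 0) = ind B p := by
  rw [Finset.sum_ite_eq']; unfold ind; rfl

/-- **Generators are nonnegative on up-sets**: `Σ_{x ∈ B} gval (lo,hi) x ≥ 0` whenever `lo ≤ hi` and `B` is an up-set. [this work] -/
theorem sum_gval_nonneg {B : Finset (Pd d)} (hB : IsUpperSet (B : Set (Pd d))) {e : Pd d × Pd d} (he : e.1 ≤ e.2) :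
    0 ≤ ∑ x ∈ B, gval e x := by
  unfold gval
  split_ifs with h
  · rw [sum_ite_eq_ind]; unfold ind; split_ifs <;> norm_num
  · rw [Finset.sum_sub_distrib, sum_ite_eq_ind, sum_ite_eq_ind]
    unfold ind
    by_cases hlo : e.1 ∈ B
    · have hhi : e.2 ∈ B := hB he hlo
      rw [if_pos hhi, if_pos hlo]; norm_num
    · rw [if_neg hlo]
      split_ifs <;> norm_num

/-! ### Slice certificates and their soundness -/

/-- The bilinear form certified by a list of terms `(c, e, e')`: `Σ c · gval e q · gval e' r`. [this work] -/
def certVal (cert : List (ℕ × (Pd d × Pd d) × (Pd d × Pd d))) (q r : Pd d) : ℤ :=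
  (cert.map fun t => (t.1 : ℤ) * (gval t.2.1 q * gval t.2.2 r)).sum

/-- **The slice-certificate checker for `A`** (Boolean, executable): `L > 0`, every generator is a point or an upward
difference (`lo ≤ hi` pointwise), and `L · Σ_{p ∈ A} t_d(p,q,r) = certVal cert q r` for all `q, r`. [this work] -/
def certCheck (A : Finset (Pd d)) (L : ℕ) (cert : List (ℕ × (Pd d × Pd d) × (Pd d × Pd d))) : Bool :=
  decide (0 < L) &&
    (cert.all fun t => decide (∀ a, t.2.1.1 a ≤ t.2.1.2 a) && decide (∀ a, t.2.2.1 a ≤ t.2.2.2 a)) &&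
    decide (∀ q r : Pd d, (L : ℤ) * (∑ p ∈ A, tcD p q r) = certVal cert q r)

/-- What the checker checks. [this work] -/
theorem certCheck_spec {A : Finset (Pd d)} {L : ℕ} {cert : List (ℕ × (Pd d × Pd d) × (Pd d × Pd d))}
    (h : certCheck A L cert = true) :
    0 < L ∧ (∀ t ∈ cert, t.2.1.1 ≤ t.2.1.2 ∧ t.2.2.1 ≤ t.2.2.2) ∧
      ∀ q r : Pd d, (L : ℤ) * (∑ p ∈ A, tcD p q r) = certVal cert q r := by
  unfold certCheck at h
  simp only [Bool.and_eq_true, decide_eq_true_eq, List.all_eq_true] at h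
  obtain ⟨⟨hL, hgen⟩, hid⟩ := h
  exact ⟨hL, fun t ht => ⟨fun a => (hgen t ht).1 a, fun a => (hgen t ht).2 a⟩, hid⟩

/-- List sums commute with double finset sums. [this work] -/
theorem sum_sum_listSum_all {ι : Type*} (l : List ι) (B C : Finset (Pd d)) (f : ι → Pd d → Pd d → ℤ) :
    (∑ q ∈ B, ∑ r ∈ C, (l.map fun e => f e q r).sum) = (l.map fun e => ∑ q ∈ B, ∑ r ∈ C, f e q r).sum := by
  induction l with
  | nil => simp
  | cons e l ih => simp [Finset.sum_add_distrib, ih]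

/-- Factoring a double sum of products. [this work] -/
theorem sum_sum_mul_all (B C : Finset (Pd d)) (c : ℤ) (a b : Pd d → ℤ) :
    (∑ q ∈ B, ∑ r ∈ C, c * (a q * b r)) = c * ((∑ q ∈ B, a q) * (∑ r ∈ C, b r)) := by
  rw [Finset.sum_mul_sum, Finset.mul_sum]
  exact Finset.sum_congr rfl fun q _ => by rw [Finset.mul_sum]

/-- **Soundness**: a slice certificate for `A` proves `Σ_{p∈A} Σ_{q∈B} Σ_{r∈C} t_d(p,q,r) ≥ 0` for ALL up-sets `B, C`. [this work] -/
theorem slicePos_of_certCheck {A : Finset (Pd d)} {L : ℕ} {cert : List (ℕ × (Pd d × Pd d) × (Pd d × Pd d))}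
    (h : certCheck A L cert = true) :
    ∀ B C : Finset (Pd d), IsUpperSet (B : Set (Pd d)) → IsUpperSet (C : Set (Pd d)) →
      0 ≤ ∑ p ∈ A, ∑ q ∈ B, ∑ r ∈ C, tcD p q r := by
  obtain ⟨hL, hgen, hid⟩ := certCheck_spec h
  intro B C hB hC
  have hswap : ∑ p ∈ A, ∑ q ∈ B, ∑ r ∈ C, tcD p q r = ∑ q ∈ B, ∑ r ∈ C, ∑ p ∈ A, tcD p q r := by
    rw [Finset.sum_comm]
    refine Finset.sum_congr rfl fun q _ => ?_
    rw [Finset.sum_comm]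
  have h2 : (L : ℤ) * ∑ q ∈ B, ∑ r ∈ C, ∑ p ∈ A, tcD p q r = ∑ q ∈ B, ∑ r ∈ C, certVal cert q r := by
    rw [Finset.mul_sum]
    refine Finset.sum_congr rfl fun q _ => ?_
    rw [Finset.mul_sum]
    exact Finset.sum_congr rfl fun r _ => hid q r
  have h3 : ∑ q ∈ B, ∑ r ∈ C, certVal cert q r =
      (cert.map fun t => (t.1 : ℤ) * ((∑ q ∈ B, gval t.2.1 q) * (∑ r ∈ C, gval t.2.2 r))).sum := by
    unfold certVal
    rw [sum_sum_listSum_all]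
    exact congrArg List.sum (List.map_congr_left fun t _ => sum_sum_mul_all B C _ _ _)
  have key : (L : ℤ) * ∑ p ∈ A, ∑ q ∈ B, ∑ r ∈ C, tcD p q r =
      (cert.map fun t => (t.1 : ℤ) * ((∑ q ∈ B, gval t.2.1 q) * (∑ r ∈ C, gval t.2.2 r))).sum := by
    rw [hswap, h2, h3]
  have hnn : 0 ≤ (cert.map fun t => (t.1 : ℤ) * ((∑ q ∈ B, gval t.2.1 q) * (∑ r ∈ C, gval t.2.2 r))).sum := by
    refine List.sum_nonneg ?_
    intro x hx
    rw [List.mem_map] at hx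
    obtain ⟨t, ht, rfl⟩ := hx
    exact mul_nonneg (by positivity) (mul_nonneg (sum_gval_nonneg hB (hgen t ht).1) (sum_gval_nonneg hC (hgen t ht).2))
  rw [← key] at hnn
  exact nonneg_of_mul_nonneg_right (by rwa [mul_comm] at hnn) (by exact_mod_cast hL)

/-- **`SliceDecomposable d`** — THE SLICE-CERTIFICATE OBLIGATION in dimension `d`: every up-set `A` of `[3]^d` has a slice
certificate (equivalently: the bilinear form `β_A = Σ_{p∈A} t_d(p,·,·)` lies in the cone `K* ⊗ K*` generated by products of point
evaluations and upward differences).  PROVED for `d ≤ 3` (generation 7, all `980` up-sets of `[3]^3`, kernel-checked in the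
`d = 3` format); `d = 4`: exact certificates computed and checked outside Lean (this seat, certificate grade); all `d`: OPEN.
An obligation / hypothesis, never a fact. [this work] [status: proved d ≤ 3 (other format); certified d = 4 in progress; open in general] -/
@[conjecture] def SliceDecomposable (d : ℕ) : Prop :=
  ∀ A : Finset (Pd d), IsUpperSet (A : Set (Pd d)) →
    ∃ (L : ℕ) (cert : List (ℕ × (Pd d × Pd d) × (Pd d × Pd d))), certCheck A L cert = true

/-- **Slice certificates for all up-sets prove the pattern inequality**: `SliceDecomposable d → PatternPos d`. [this work] -/
theorem patternPos_of_sliceDecomposable (h : SliceDecomposable d) : PatternPos d := by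
  intro A B C hA hB hC
  obtain ⟨L, cert, hc⟩ := h A hA
  rw [sStarD_eq_sum_tcD]
  exact slicePos_of_certCheck hc B C hB hC

/-! ### One certificate per axis orbit suffices -/

/-- Precomposition with an axis permutation, as an equivalence of `[3]^d`. [this work] -/
def compEquivD (τ : Equiv.Perm (Fin d)) : Pd d ≃ Pd d where
  toFun p := p ∘ τ
  invFun p := p ∘ τ.symm
  left_inv p := by funext a; simp
  right_inv p := by funext a; simp

/-- **The tensor is invariant under the axis symmetries** (every dimension). [this work] -/
theorem tcD_perm (τ : Equiv.Perm (Fin d)) (p q r : Pd d) : tcD (p ∘ τ) (q ∘ τ) (r ∘ τ) = tcD p q r := by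
  unfold tcD
  simp only [Function.comp_apply]
  rw [Equiv.prod_comp τ (fun a => c1 (p a) (q a) (r a)), Equiv.prod_comp τ (fun a => c2 (p a) (q a) (r a)),
    Equiv.prod_comp τ (fun a => c2 (q a) (p a) (r a)), Equiv.prod_comp τ (fun a => c2 (r a) (p a) (q a)),
    Equiv.prod_comp τ (fun a => c3 (p a) (q a) (r a))]

/-- Images of up-sets under an axis symmetry are up-sets. [this work] -/
theorem isUpperSet_map_compEquivD (τ : Equiv.Perm (Fin d)) {B : Finset (Pd d)} (hB : IsUpperSet (B : Set (Pd d))) :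
    IsUpperSet ((B.map (compEquivD τ).toEmbedding : Finset (Pd d)) : Set (Pd d)) := by
  intro x y hxy hx
  rw [Finset.mem_coe, Finset.mem_map_equiv] at hx ⊢
  refine hB (fun a => ?_) hx
  show x (τ.symm a) ≤ y (τ.symm a)
  exact hxy _

/-- **Transfer of slice positivity** along an axis symmetry: if `p ∈ A' ↔ p ∘ τ ∈ A` and `A` is slice-positive, so is `A'`. [this work] -/
theorem slicePos_perm (τ : Equiv.Perm (Fin d)) {A A' : Finset (Pd d)}
    (hA : ∀ B C : Finset (Pd d), IsUpperSet (B : Set (Pd d)) → IsUpperSet (C : Set (Pd d)) →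
      0 ≤ ∑ p ∈ A, ∑ q ∈ B, ∑ r ∈ C, tcD p q r)
    (h : ∀ p, p ∈ A' ↔ p ∘ τ ∈ A) :
    ∀ B C : Finset (Pd d), IsUpperSet (B : Set (Pd d)) → IsUpperSet (C : Set (Pd d)) →
      0 ≤ ∑ p ∈ A', ∑ q ∈ B, ∑ r ∈ C, tcD p q r := by
  intro B' C' hB' hC'
  let e : Pd d ≃ Pd d := compEquivD τ
  have hsum : ∑ p ∈ A', ∑ q ∈ B', ∑ r ∈ C', tcD p q r =
      ∑ p ∈ A, ∑ q ∈ B'.map e.toEmbedding, ∑ r ∈ C'.map e.toEmbedding, tcD p q r := by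
    refine Finset.sum_equiv e (fun p => ?_) fun p _ => ?_
    · rw [h p]; rfl
    · refine Finset.sum_equiv e (fun q => ?_) fun q _ => ?_
      · rw [Finset.mem_map_equiv, Equiv.symm_apply_apply]
      · refine Finset.sum_equiv e (fun r => ?_) fun r _ => ?_
        · rw [Finset.mem_map_equiv, Equiv.symm_apply_apply]
        · exact (tcD_perm τ p q r).symm
  rw [hsum]
  exact hA _ _ (isUpperSet_map_compEquivD τ hB') (isUpperSet_map_compEquivD τ hC')

/-- **One slice certificate per axis orbit proves the pattern inequality**: if every up-set `A` of `[3]^d` is an axis-permuted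
copy (`p ∈ A ↔ p ∘ τ ∈ A₀`) of some `A₀` carrying a certificate, then `PatternPos d`. [this work] -/
theorem patternPos_of_certs_upToAxisPerm
    (h : ∀ A : Finset (Pd d), IsUpperSet (A : Set (Pd d)) →
      ∃ (τ : Equiv.Perm (Fin d)) (A₀ : Finset (Pd d)) (L : ℕ) (cert : List (ℕ × (Pd d × Pd d) × (Pd d × Pd d))),
        certCheck A₀ L cert = true ∧ ∀ p, p ∈ A ↔ p ∘ τ ∈ A₀) :
    PatternPos d := by
  intro A B C hA hB hC
  obtain ⟨τ, A₀, L, cert, hc, hmem⟩ := h A hA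
  rw [sStarD_eq_sum_tcD]
  exact slicePos_perm τ (slicePos_of_certCheck hc) hmem B C hB hC

/-! ### Consequences (composition with the generation-7 reductions) -/

/-- `SliceDecomposable d ⟹` layer `P(d,3)`: every product probability weight on every `d`-dimensional grid is Sahi-positive of
order 3. [this work] -/
theorem liebSahi_grid_of_sliceDecomposable (h : SliceDecomposable d) :
    ∀ (K : ℕ) (g : Fin d → Fin (K + 1) → ℝ), (∀ i u, 0 ≤ g i u) → (∀ i, ∑ u, g i u = 1) →
      Literature.Combinatorics.Sahi2008.SahiPositive (fun ω : Fin d → Fin (K + 1) => ∏ i, g i (ω i)) 3 :=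
  liebSahi_grid_of_patternPos (patternPos_of_sliceDecomposable h)

/-- `SliceDecomposable d ⟹` Sahi's `C₃` for EVERY FKG weight on every `d`-dimensional grid. [this work] -/
theorem fkg_grid_of_sliceDecomposable (h : SliceDecomposable d) :
    ∀ (b : ℕ) (μ : (Fin d → Fin (b + 1)) → ℝ), Literature.Combinatorics.Sahi2008.IsFKGMeasure μ →
      Literature.Combinatorics.Sahi2008.SahiPositive μ 3 :=
  fkg_grid_of_patternPos (patternPos_of_sliceDecomposable h)

/-- `SliceDecomposable d ⟹` Lieb–Sahi's Conjecture 1.1 on `[0,1]^d` at order 3. [this work] -/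
theorem liebSahiContinuum_of_sliceDecomposable (h : SliceDecomposable d) : LiebSahiContinuum d 3 :=
  liebSahiContinuum_of_patternPos (patternPos_of_sliceDecomposable h)

/-- **Slice certificates in every dimension would prove Kahn's Conjecture 5.** [this work] -/
theorem kahnConjecture_of_forall_sliceDecomposable (h : ∀ d, SliceDecomposable d) : KahnConjecture :=
  kahnConjecture_of_forall_patternPos fun d => patternPos_of_sliceDecomposable (h d)

/-! ### A worked example (`d = 1`) -/

/-- The point of `[3]^1` with value `v`. [this work] -/
def pt1 (v : Fin 3) : Pd 1 := fun _ => v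

/-- EXAMPLE (`d = 1`, the top slice `A = {2}`): `β_A = δ₀⊗Δ_{01} + Δ_{12}⊗Δ_{01} + Δ_{01}⊗δ₂ + 2·δ₂⊗Δ_{12} + 2·Δ_{12}⊗δ₂`
passes the checker (by `decide`). [this work] -/
example : certCheck ({pt1 2} : Finset (Pd 1)) 1
    [(1, (pt1 0, pt1 0), (pt1 0, pt1 1)), (1, (pt1 1, pt1 2), (pt1 0, pt1 1)), (1, (pt1 0, pt1 1), (pt1 2, pt1 2)),
     (2, (pt1 2, pt1 2), (pt1 1, pt1 2)), (2, (pt1 1, pt1 2), (pt1 2, pt1 2))] = true := by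
  decide

end Summit.CriticalPhenomena.PercolationContinuityZ3.Theorems.SahiGridPattern
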